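import Summits.BirchSwinnertonDyer.Rank1Residual.SmallImageMu.FirstLayerCriteria
import Summits.BirchSwinnertonDyer.Rank1Residual.SmallImageMu.ConjARoad
import Summits.BirchSwinnertonDyer.Rank1Residual.SmallImageMu.KatoDivisibility
import HarnessLib
import HarnessLib.Audit

/-!
# Kernel glue of the first-layer criteria: per certified clean X9 pair the crux AT THE PAIR; if every X9
# pair were certified, the node `KatoDivisibilityOnClassX9` and DESC-A (the literal class-wide shapes)

HONEST FRAMING (cell `bsd-f3-mu`).  THEOREMS ONLY, sorry-free; CONDITIONAL, credits nothing.  The class-wide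
antecedent `hall` («every X9 pair is tame, clean and (ε or δ)-certified») is DATA, expected FALSE class-wide
(MEMO-desc §10.2: rank-1 clean rows have `Y ≠ 0`-compatible class groups) — these theorems are ENGINES
recording the literal shape `criterion ∧ certificates ⟹ node`, not theses.  Per pair the work is the
Literature glue `Rank1Residual.katoDivisibilityAt_of_firstLayerCapitulationCert / …RankCert` over the
carriers' engine `Rank1Residual.ConjAAt.katoDivisibilityAt` (T0 proved; S-W⁺ `k ≤ μ(X₀)` as hypothesis
`hSW`; F1; BCS (a); modularity).  Ported from `HOME/desc/Sketch3.lean` §5–§6 onto the filed names.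

References: [DeoRaySujatha2023] Thm. 3.9; [Kato2004Asterisque] §17.13; HOME MEMO-desc.md §10.
-/

-- the summit and its single problem are both named `BirchSwinnertonDyer` (registry layout D-0017)
set_option linter.dupNamespace false

noncomputable section

open scoped Classical MatrixGroups ModularForm

open CongruenceSubgroup WeierstrassCurve Field Literature.NumberTheory.EllipticCurves
  Literature.NumberTheory.EllipticCurves.ModularForms Literature.NumberTheory.IwasawaTheory
  Summit.BirchSwinnertonDyer.BirchSwinnertonDyer.Rank1Residual
open Literature.NumberTheory.EllipticCurves.Rank1Residual (ConjAAt TameAt CleanAt FirstLayerRankCertAt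
  FirstLayerCapitulationCertAt MuDefectLeFineMuAt KatoDivisibilityAt
  katoDivisibilityAt_of_firstLayerCapitulationCert katoDivisibilityAt_of_firstLayerRankCert)

namespace Summit.BirchSwinnertonDyer.Rank1Residual.SmallImageMu

/-- **If every X9 pair were tame, clean and ε-certified, the crux `KatoDivisibilityOnClassX9` would follow
from the capitulation criterion** (+ S-W⁺ on X9, F1, BCS (a), modularity) — the literal class-wide shape;
`hall` is data, expected false class-wide (an engine, not a thesis). [cite: DeoRaySujatha2023, Thm. 3.9 (arXiv:2202.09937 pp. 9–10)]
[cite: Kato2004Asterisque, §17.13 (pp. 279–280)] -/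
theorem katoDivisibilityOnClassX9_of_capitulationCriterion_of_allCertified
    (hC : FirstLayerCapitulationCriterion)
    (hBCS : burungale_castella_skinner_charIdeal_eq_padicLFunction)
    (hmodP : nonempty_modularParametrizationData)
    (hfine : Kato2004.exists_divisibilityInputs_fineQuotient)
    (hSW : ∀ (W : WeierstrassCurve ℚ) [W.IsElliptic] [W.IsGloballyMinimal] (p : ℕ) [Fact p.Prime],
      ClassX9 W p → MuDefectLeFineMuAt W p)
    (hall : ∀ (W : WeierstrassCurve ℚ) [W.IsElliptic] [W.IsGloballyMinimal] (p : ℕ) [Fact p.Prime],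
      ClassX9 W p → TameAt W p ∧ CleanAt W p ∧ FirstLayerCapitulationCertAt W p) :
    KatoDivisibilityOnClassX9 := by
  intro W _ _ p _ κ γ N _ f hX9 hκ hγ hγ' hf D
  obtain ⟨-, hp, hgood, hord, hirr, -⟩ := id hX9
  obtain ⟨htame, hclean, hcert⟩ := hall W p hX9
  exact (katoDivisibilityAt_of_firstLayerCapitulationCert hC hBCS hmodP hfine hp hgood hord hirr
    (hSW W p hX9) htame hclean hcert) κ γ f hκ hγ hγ' hf D

/-- **Same with the rank criterion δ.** [cite: Lang1990, Ch. 13 §1 Lemma 3] [cite: Kato2004Asterisque, §17.13 (pp. 279–280)] -/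
theorem katoDivisibilityOnClassX9_of_rankCriterion_of_allCertified
    (hC : FirstLayerRankCriterion)
    (hBCS : burungale_castella_skinner_charIdeal_eq_padicLFunction)
    (hmodP : nonempty_modularParametrizationData)
    (hfine : Kato2004.exists_divisibilityInputs_fineQuotient)
    (hSW : ∀ (W : WeierstrassCurve ℚ) [W.IsElliptic] [W.IsGloballyMinimal] (p : ℕ) [Fact p.Prime],
      ClassX9 W p → MuDefectLeFineMuAt W p)
    (hall : ∀ (W : WeierstrassCurve ℚ) [W.IsElliptic] [W.IsGloballyMinimal] (p : ℕ) [Fact p.Prime],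
      ClassX9 W p → TameAt W p ∧ CleanAt W p ∧ FirstLayerRankCertAt W p) :
    KatoDivisibilityOnClassX9 := by
  intro W _ _ p _ κ γ N _ f hX9 hκ hγ hγ' hf D
  obtain ⟨-, hp, hgood, hord, hirr, -⟩ := id hX9
  obtain ⟨htame, hclean, hcert⟩ := hall W p hX9
  exact (katoDivisibilityAt_of_firstLayerRankCert hC hBCS hmodP hfine hp hgood hord hirr
    (hSW W p hX9) htame hclean hcert) κ γ f hκ hγ hγ' hf D

/-- **Criterion ε + certificates at every X9 pair ⟹ DESC-A** (`ConjAOnClassX9`), with no other input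
(tame and clean are the criterion's own hypotheses; X9 pairs have `p ≥ 5`). [cite: DeoRaySujatha2023, Thm. 3.9] -/
theorem conjAOnClassX9_of_capitulationCriterion_of_allCertified (hC : FirstLayerCapitulationCriterion)
    (hall : ∀ (W : WeierstrassCurve ℚ) [W.IsElliptic] [W.IsGloballyMinimal] (p : ℕ) [Fact p.Prime],
      ClassX9 W p → TameAt W p ∧ CleanAt W p ∧ FirstLayerCapitulationCertAt W p) :
    ConjAOnClassX9 := by
  intro W _ _ p _ hX9
  obtain ⟨-, hp, -, -, hirr, -⟩ := id hX9
  obtain ⟨htame, hclean, hcert⟩ := hall W p hX9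
  exact hC W p (by omega) hirr htame hclean hcert

/-- **Criterion δ + certificates at every X9 pair ⟹ DESC-A.** [cite: Lang1990, Ch. 13 §1 Lemma 3] -/
theorem conjAOnClassX9_of_rankCriterion_of_allCertified (hC : FirstLayerRankCriterion)
    (hall : ∀ (W : WeierstrassCurve ℚ) [W.IsElliptic] [W.IsGloballyMinimal] (p : ℕ) [Fact p.Prime],
      ClassX9 W p → TameAt W p ∧ CleanAt W p ∧ FirstLayerRankCertAt W p) :
    ConjAOnClassX9 := by
  intro W _ _ p _ hX9
  obtain ⟨-, hp, -, -, hirr, -⟩ := id hX9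
  obtain ⟨htame, hclean, hcert⟩ := hall W p hX9
  exact hC W p (by omega) hirr htame hclean hcert

end Summit.BirchSwinnertonDyer.Rank1Residual.SmallImageMu

end
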